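import Summits.ValiantsHypothesis.ValiantsHypothesis.Theorems.LacunarySymmetroidMatrixDescartesCensusAtomM5K4QF40
import Summits.ValiantsHypothesis.ValiantsHypothesis.Theorems.LacunarySymmetroidMatrixDescartesCensusAtomM5K5EB58

/-!
# `MatrixDescartes` census — MIXED JUNCTION ROWS at `m = 5` from the atom blocks (block words, one line each)

HONEST FRAMING.  Experiment cell `val-V1-extremal`, width seat val-v1x-eng-8 g3 (`mixgen.py`).  Each theorem below is a census LOWER bound
`¬ PosRootLawAt 5 K (N − 1)` («some real symmetric `K`-letter `5 × 5` lacunary pencil has `N` distinct positive determinant roots»)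
obtained from kernel-certified ATOM BLOCKS of this cell (files `…CensusAtom*`: alternation certificate + Sylvester forms of the end letters,
all checked by the kernel) by the tree's JUNCTION LAW for matching junction inertia (`Chain.chain_append`, `…ChainInertia` /
`…ChainBlocks`, seat val-sym-mdr-p1) — alternation counts ADD, letter counts add minus one per junction — plus trailing grafts
(`+5` per added letter, `Reflect.not_posRootLawAt_of_certificateT_add`).  `ʳ` = block reversed (`x ↦ 1/x`, `Reflect.block_reverse`),
`⁻` = all letters negated (`blockNeg`).  No explicit chained pencil is ever written: the kernel checks each atom once and the words here
are bookkeeping.  Rows: (5,8) ≥ 98 [M5K4QF40 ▹ M5K5EB58] (was 85); (5,11) ≥ 138 [M5K4QF40 ▹ M5K4QF40 ▹ M5K5EB58] (was 126); (5,12) ≥ 156 [M5K4QF40 ▹ M5K5EB58 ▹ M5K5EB58] (was 131); (5,13) ≥ 174 [M5K5EB58 ▹ M5K5EB58 ▹ M5K5EB58] (was 148).  CONSTRUCTION-FAMILY provenance (junctions of flags/caps/towers found by the cell's engine seats —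
credits in the atom files).  Nothing here bears on the asymptotic crux `Theses.LacunarySymmetroid.MatrixDescartes`
(stmt-ValiantsHypothesis-18050) nor on `VP ≠ VNP`; VP ≠ VNP is NOT proved.  Generated 2026-08-29T03:13Z.  [folklore]
-/

-- `Summit.ValiantsHypothesis.ValiantsHypothesis.…` repeats a component by the D-0017 layout
-- (single-conjunct summit), which the `dupNamespace` linter flags; the name is mandated.
set_option linter.dupNamespace false

namespace Summit.ValiantsHypothesis.ValiantsHypothesis.Theorems.LacunarySymmetroidMatrixDescartes.Census.Reflect.MixM5

open Summit.ValiantsHypothesis.ValiantsHypothesis.Theorems.MatrixDescartes.Negative (PosRootLawAt)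
open Summit.ValiantsHypothesis.ValiantsHypothesis.Theorems.LacunarySymmetroidMatrixDescartes.Census
open Summit.ValiantsHypothesis.ValiantsHypothesis.Theorems.LacunarySymmetroidMatrixDescartes.Census.Reflect

/-- **`ζ_sym(5,8) ≥ 98`** (`¬ PosRootLawAt 5 8 97`) — the block word `M5K4QF40 ▹ M5K5EB58` = `40 + 58` alternations on
`4 + 5 − 1` letters (junction law for matching junction inertia; kernel value before this file: 85). QUADFLAG40 ▹ ENDBOTH58 on the common (3,2) end letters (atoms by val-v1x-eng-2 g2 (quadric-seeded flags)). [folklore] -/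
theorem mix_5_8 : ¬ PosRootLawAt 5 8 97 := by
  have h := Chain.not_posRootLawAt_of_certificateT (by norm_num)
      (Chain.chain_append (by norm_num) (Chain.chain_of_block Reflect.AtomM5K4QF40.block)
        Reflect.AtomM5K5EB58.block (Equiv.refl (Fin 5)) (by intro i; fin_cases i <;> norm_num))
  norm_num at h
  exact h

/-- **`ζ_sym(5,11) ≥ 138`** (`¬ PosRootLawAt 5 11 137`) — the block word `M5K4QF40 ▹ M5K4QF40 ▹ M5K5EB58` = `40 + 40 + 58` alternations on
`4 + 4 + 5 − 2` letters (junction law for matching junction inertia; kernel value before this file: 126). [folklore] -/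
theorem mix_5_11 : ¬ PosRootLawAt 5 11 137 := by
  have h := Chain.not_posRootLawAt_of_certificateT (by norm_num)
      (Chain.chain_append (by norm_num) (Chain.chain_append (by norm_num) (Chain.chain_of_block Reflect.AtomM5K4QF40.block)
        Reflect.AtomM5K4QF40.block (Equiv.refl (Fin 5)) (by intro i; fin_cases i <;> norm_num))
        Reflect.AtomM5K5EB58.block (Equiv.refl (Fin 5)) (by intro i; fin_cases i <;> norm_num))
  norm_num at h
  exact h

/-- **`ζ_sym(5,12) ≥ 156`** (`¬ PosRootLawAt 5 12 155`) — the block word `M5K4QF40 ▹ M5K5EB58 ▹ M5K5EB58` = `40 + 58 + 58` alternations on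
`4 + 5 + 5 − 2` letters (junction law for matching junction inertia; kernel value before this file: 131). [folklore] -/
theorem mix_5_12 : ¬ PosRootLawAt 5 12 155 := by
  have h := Chain.not_posRootLawAt_of_certificateT (by norm_num)
      (Chain.chain_append (by norm_num) (Chain.chain_append (by norm_num) (Chain.chain_of_block Reflect.AtomM5K4QF40.block)
        Reflect.AtomM5K5EB58.block (Equiv.refl (Fin 5)) (by intro i; fin_cases i <;> norm_num))
        Reflect.AtomM5K5EB58.block (Equiv.refl (Fin 5)) (by intro i; fin_cases i <;> norm_num))
  norm_num at h
  exact h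

/-- **`ζ_sym(5,13) ≥ 174`** (`¬ PosRootLawAt 5 13 173`) — the block word `M5K5EB58 ▹ M5K5EB58 ▹ M5K5EB58` = `58 + 58 + 58` alternations on
`5 + 5 + 5 − 2` letters (junction law for matching junction inertia; kernel value before this file: 148). [folklore] -/
theorem mix_5_13 : ¬ PosRootLawAt 5 13 173 := by
  have h := Chain.not_posRootLawAt_of_certificateT (by norm_num)
      (Chain.chain_append (by norm_num) (Chain.chain_append (by norm_num) (Chain.chain_of_block Reflect.AtomM5K5EB58.block)
        Reflect.AtomM5K5EB58.block (Equiv.refl (Fin 5)) (by intro i; fin_cases i <;> norm_num))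
        Reflect.AtomM5K5EB58.block (Equiv.refl (Fin 5)) (by intro i; fin_cases i <;> norm_num))
  norm_num at h
  exact h

end Summit.ValiantsHypothesis.ValiantsHypothesis.Theorems.LacunarySymmetroidMatrixDescartes.Census.Reflect.MixM5
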